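import Literature.AlgebraicGeometry.Resolution.StrictTransformTorsion
import Mathlib.AlgebraicGeometry.Morphisms.Flat
import HarnessLib

/-!
# Flatness of the strict transform over an affine chart: a ring-theoretic criterion

Topic: `Literature/AlgebraicGeometry/Resolution`. Let `f : X → S`, `b : S' → S` with
`X ×_S S'` and `S'` affine, and suppose the complement of the pulled-back centre `b⁻¹(S ∖ V(𝓘))`
is a global basic open `D(t)` of `S'` (as on any affine chart of a blowing up in `𝓘`, where
`𝓘 𝒪_{S'} = (t)`). Writing `C = Γ(X ×_S S')` and `t_C` for the image of `t`, the strict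
transform `X'` (Stacks 080D (2), `blowupStrictTransform`) is the affine scheme
`Spec C/(t_C-power torsion)` (its ideal is the `t_C`-power torsion, Stacks 080C,
`StrictTransformTorsion.lean`), so that

* `ideal_top_blowupStrictTransform_eq` — the ideal of `X'` on the whole of `X ×_S S'` is the
  `t_C`-power torsion ideal of `C`;
* `flat_blowupStrictTransformMap_iff_ringHom_flat` — **`X' → S'` is flat iff the ring map
  `Γ(S') → C → C/(t_C-power torsion)` is flat.**

This isolates the scheme-theoretic part of "the strict transform of an affine `X` over an affine
chart of the blow-up is `Spec` of the torsion quotient of the base change" from the algebra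
(`BlowupFittingIdealFlatCartier.lean`: that quotient is flat for `X` finite over an affine `S`
blown up in a Fitting ideal).

## References

* The Stacks Project, Tag 080C, Tag 080D; Tag 0810 (proof, Step 8). [StacksProject]
-/

noncomputable section

open CategoryTheory CategoryTheory.Limits AlgebraicGeometry TopologicalSpace

namespace Literature.AlgebraicGeometry.Resolution

universe u

variable {X S S' : Scheme.{u}} (f : X ⟶ S) (b : S' ⟶ S) (I : S.IdealSheafData)

/-- The `c`-power torsion ideal `{x ∣ ∃ n, cⁿ x = 0}` of a commutative ring. [folklore] -/
def powTorsionIdeal {C : Type u} [CommRing C] (c : C) : Ideal C :=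
  ⨆ n : ℕ, Submodule.torsionBy C C (c ^ n)

/-- Membership in the `c`-power torsion ideal. [folklore] -/
theorem mem_powTorsionIdeal_iff {C : Type u} [CommRing C] (c x : C) :
    x ∈ powTorsionIdeal c ↔ ∃ n : ℕ, c ^ n * x = 0 := by
  unfold powTorsionIdeal
  have hmono : Monotone fun n : ℕ => Submodule.torsionBy C C (c ^ n) := by
    intro n m hnm y hy
    rw [Submodule.mem_torsionBy_iff] at hy ⊢
    obtain ⟨d, rfl⟩ := Nat.exists_eq_add_of_le hnm
    rw [add_comm, pow_add, mul_smul, hy, smul_zero]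
  rw [Submodule.mem_iSup_of_directed _ hmono.directed_le]
  simp only [Submodule.mem_torsionBy_iff, smul_eq_mul]

/-- **The ideal of the strict transform on an affine `X ×_S S'` is the torsion ideal**: if
`b⁻¹(S ∖ V(𝓘)) = D(t)` for a global section `t` of `S'` (and `b⁻¹𝓘 𝒪_{S'}` is an effective
Cartier divisor), the ideal of `X' ⊆ X ×_S S'` on the whole (affine) `X ×_S S'` is the
`t_C`-power torsion ideal of `C = Γ(X ×_S S')`, `t_C` the image of `t`.
[cite: StacksProject, Tag 080C] -/
theorem ideal_top_blowupStrictTransform_eq [IsAffine (pullback f b)]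
    (hE : IsEffectiveCartier (I.comap b)) (t : Γ(S', ⊤))
    (hO : b ⁻¹ᵁ centreCompl I = S'.basicOpen t) :
    (blowupStrictTransformι f b I).ker.ideal ⟨⊤, isAffineOpen_top _⟩ =
      powTorsionIdeal ((pullback.snd f b).appTop t) := by
  ext x
  rw [mem_powTorsionIdeal_iff]
  refine mem_ideal_blowupStrictTransform_iff f b I hE ⟨⊤, isAffineOpen_top _⟩ _ ?_ x
  show (pullback.snd f b ⁻¹ᵁ (b ⁻¹ᵁ centreCompl I)) ⊓ ⊤ = (pullback f b).basicOpen _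
  rw [inf_top_eq, hO, Scheme.preimage_basicOpen_top]

/-- **Flatness of the strict transform over an affine chart is flatness of the torsion
quotient**: with `X ×_S S'` and `S'` affine and `b⁻¹(S ∖ V(𝓘)) = D(t)`, `X' → S'` is flat iff
the ring map `Γ(S') → C/(t_C-power torsion)` (`C = Γ(X ×_S S')`) is flat — `X'` is affine
with `Γ(X') = C/(t_C-power torsion)`. [cite: StacksProject, Tag 0810 (proof, Step 8)] -/
theorem flat_blowupStrictTransformMap_iff_ringHom_flat [IsAffine (pullback f b)] [IsAffine S']
    (hE : IsEffectiveCartier (I.comap b)) (t : Γ(S', ⊤))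
    (hO : b ⁻¹ᵁ centreCompl I = S'.basicOpen t) :
    Flat (blowupStrictTransformMap f b I) ↔
      ((Ideal.Quotient.mk (powTorsionIdeal ((pullback.snd f b).appTop t))).comp
        (pullback.snd f b).appTop.hom).Flat := by
  haveI : IsAffine (blowupStrictTransform f b I) := isAffine_of_isAffineHom (blowupStrictTransformι f b I)
  -- `Γ(X') = C / ker`, `ker` the ideal of `X'`, which is the torsion ideal
  have hsurj : Function.Surjective (blowupStrictTransformι f b I).appTop :=
    (blowupStrictTransformι f b I).app_surjective ⊤ (isAffineOpen_top _)
  have hker : RingHom.ker (blowupStrictTransformι f b I).appTop.hom =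
      powTorsionIdeal ((pullback.snd f b).appTop t) := by
    rw [← ideal_top_blowupStrictTransform_eq f b I hE t hO, ker_blowupStrictTransformι]
    exact Scheme.IdealSheafData.ker_subschemeι_app _ ⟨⊤, isAffineOpen_top _⟩
  -- the quotient presentation of `Γ(X')`
  let e : Γ(pullback f b, ⊤) ⧸ RingHom.ker (blowupStrictTransformι f b I).appTop.hom ≃+*
      Γ(blowupStrictTransform f b I, ⊤) :=
    RingHom.quotientKerEquivOfSurjective hsurj
  have happ : (blowupStrictTransformMap f b I).appTop.hom =
      e.toRingHom.comp ((Ideal.Quotient.mk _).comp (pullback.snd f b).appTop.hom) := by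
    change (blowupStrictTransformι f b I ≫ pullback.snd f b).appTop.hom = _
    rw [Scheme.Hom.comp_appTop, CommRingCat.hom_comp]
    ext x
    simp only [RingHom.comp_apply]
    exact (RingHom.quotientKerEquivOfSurjective_apply_mk hsurj _).symm
  rw [HasRingHomProperty.iff_of_isAffine (P := @Flat), happ]
  -- transport along the ring isomorphism `e` and the equality of ideals `ker = torsion`
  constructor
  · intro h
    have h' := RingHom.Flat.respectsIso.1 (e.toRingHom.comp ((Ideal.Quotient.mk _).comp
      (pullback.snd f b).appTop.hom)) e.symm h
    have hcomp : e.symm.toRingHom.comp (e.toRingHom.comp ((Ideal.Quotient.mk _).comp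
        (pullback.snd f b).appTop.hom)) =
        (Ideal.Quotient.mk _).comp (pullback.snd f b).appTop.hom := by
      ext x
      simp
    rw [hcomp] at h'
    -- change the ideal along `hker`
    have h'' := RingHom.Flat.respectsIso.1 _ (Ideal.quotEquivOfEq hker) h'
    convert h'' using 1
    ext x
    simp [Ideal.quotEquivOfEq_mk]
  · intro h
    have h' := RingHom.Flat.respectsIso.1 _ (Ideal.quotEquivOfEq hker.symm) h
    have hcomp : (Ideal.quotEquivOfEq hker.symm).toRingHom.comp
        ((Ideal.Quotient.mk (powTorsionIdeal ((pullback.snd f b).appTop t))).comp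
          (pullback.snd f b).appTop.hom) =
        (Ideal.Quotient.mk _).comp (pullback.snd f b).appTop.hom := by
      ext x
      simp [Ideal.quotEquivOfEq_mk]
    rw [hcomp] at h'
    exact RingHom.Flat.respectsIso.1 _ e h'

end Literature.AlgebraicGeometry.Resolution

end
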